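import Mathlib
import Literature.Analysis.FluidPDE.OseenDuhamelPairCalculus
import Literature.Analysis.FluidPDE.KNSSMildDecayHorizontal
import Literature.Analysis.FluidPDE.KochTataruKernel

/-!
# Route PlaneEnergyCeiling · crux `PlanarEnergyAPriori` — decay persistence, file 1:
# near/far pointwise bound for the Oseen–Duhamel term

Helper file for the crux item stmt-NavierStokesRegularity-16855 (`PlanarEnergyAPriori`, route
`PlaneEnergyCeiling`), landed `--supports` that item, on the proof path of the registered stub
`stub_decayPersistence` of the line `birth` (order-(3,2) spatial decay persists along a
classical Leray–Hopf solution from a rapidly decaying datum). The decay of the velocity is read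
off the Oseen integral equation `u(t) = e^{(t-s)Δ}u(s) - B¹_s(u,u)(t)`; this file supplies the
one estimate on the bilinear term that the bootstrap uses, for the slice operator
`N_σ[a,b](x) = ∫ K(σ, x-y)[a y, b y] dy` and for `B¹_s(a,b)(t)(x) = ∫_{(s,t)} N_{t-τ}[a τ, b τ](x) dτ`
(tree: `oseenSlice`, `oseenDuhamel`), with the Koch–Tataru / KNSS kernel bound
`‖K(σ,z)[a,b]‖ ≤ C₀ (σ + ‖z‖²)⁻² ‖a‖ ‖b‖` (`exists_norm_oseenKernel_three_le`):

* sources FAR from `x` (`‖y - x‖ ≥ ρ`) see the kernel at size `≤ C₀ ρ⁻⁴`, so they contribute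
  `≤ C₀ ρ⁻⁴ ∫ ‖a‖‖b‖` per unit time;
* sources NEAR `x` (`‖y - x‖ < ρ`) contribute `≤ C₀ I σ^{-1/2} · sup_{‖y-x‖<ρ} ‖a y‖‖b y‖`
  (`I = ∫ (1 + ‖w‖²)⁻² dw`), i.e. the usual `√(t-s)` after the time integration.

Main statements (all proved, [folklore]; Brandolese 2004 / Miyakawa 2002 use exactly this
splitting to propagate spatial decay along mild solutions):

* `lintegral_enorm_mul_enorm_le_of_sq` — `∫ ‖a‖‖b‖ ≤ √E_a √E_b` from `∫‖a‖² ≤ E_a`, `∫‖b‖² ≤ E_b`;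
* `exists_norm_oseenSlice_le_far_add_near` — the slice estimate;
* `exists_norm_oseenDuhamel_le_far_add_near` — the Duhamel estimate
  `‖B¹_s(a,b)(t)(x)‖ ≤ C (t-s) ρ⁻⁴ J + C √(t-s) η`.

References: L. Brandolese, *Space-time decay of Navier–Stokes flows invariant under rotations*,
Math. Ann. 329 (2004) (arXiv:math/0403136), §2; T. Miyakawa, Funkcial. Ekvac. 45 (2002);
G. Koch, N. Nadirashvili, G. Seregin, V. Šverák, Acta Math. 203 (2009), §3 (3.8).
-/

noncomputable section

-- single-conjunct summit: `Summit.<Summit>.<Problem>` repeats the name by the D-0017 layout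
set_option linter.dupNamespace false

namespace Summit.NavierStokesRegularity.NavierStokesRegularity.Theorems.PlanarEnergyAPriori

open MeasureTheory Set Filter Topology Function Metric
open scoped ENNReal NNReal
open Literature.Analysis.FluidPDE

/-! ### Cauchy–Schwarz for the source strength -/

/-- **`∫ ‖a‖‖b‖ ≤ √E_a √E_b`** (Cauchy–Schwarz in `ℝ≥0∞`) for a.e.-measurable fields with
`∫ ‖a‖² ≤ E_a`, `∫ ‖b‖² ≤ E_b`. [folklore] -/
theorem lintegral_enorm_mul_enorm_le_of_sq {a b : (EuclideanSpace ℝ (Fin 3)) → (EuclideanSpace ℝ (Fin 3))} (ha : AEMeasurable a volume)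
    (hb : AEMeasurable b volume) {Ea Eb : ℝ} (hEa : 0 ≤ Ea) (hEb : 0 ≤ Eb)
    (h2a : ∫⁻ y, ‖a y‖ₑ ^ 2 ≤ ENNReal.ofReal Ea) (h2b : ∫⁻ y, ‖b y‖ₑ ^ 2 ≤ ENNReal.ofReal Eb) :
    ∫⁻ y, ‖a y‖ₑ * ‖b y‖ₑ ≤ ENNReal.ofReal (Real.sqrt Ea * Real.sqrt Eb) := by
  have hpq : Real.HolderConjugate 2 2 := Real.HolderConjugate.two_two
  have h := ENNReal.lintegral_mul_le_Lp_mul_Lq volume hpq ha.enorm hb.enorm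
  refine h.trans ?_
  have h1 : (∫⁻ y, ‖a y‖ₑ ^ (2 : ℝ)) ^ (1 / (2 : ℝ)) ≤ ENNReal.ofReal (Real.sqrt Ea) := by
    have : (∫⁻ y, ‖a y‖ₑ ^ (2 : ℝ)) = ∫⁻ y, ‖a y‖ₑ ^ 2 := by
      refine lintegral_congr fun y => ?_
      rw [← ENNReal.rpow_natCast]; norm_num
    rw [this, Real.sqrt_eq_rpow, ← ENNReal.ofReal_rpow_of_nonneg hEa (by norm_num)]
    exact ENNReal.rpow_le_rpow h2a (by norm_num)
  have h2 : (∫⁻ y, ‖b y‖ₑ ^ (2 : ℝ)) ^ (1 / (2 : ℝ)) ≤ ENNReal.ofReal (Real.sqrt Eb) := by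
    have : (∫⁻ y, ‖b y‖ₑ ^ (2 : ℝ)) = ∫⁻ y, ‖b y‖ₑ ^ 2 := by
      refine lintegral_congr fun y => ?_
      rw [← ENNReal.rpow_natCast]; norm_num
    rw [this, Real.sqrt_eq_rpow, ← ENNReal.ofReal_rpow_of_nonneg hEb (by norm_num)]
    exact ENNReal.rpow_le_rpow h2b (by norm_num)
  rw [ENNReal.ofReal_mul (Real.sqrt_nonneg _)]
  exact mul_le_mul' h1 h2

/-! ### The slice estimate -/

/-- The far-field kernel weight: for `σ > 0`, `ρ > 0` and `ρ ≤ ‖z‖`,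
`(σ + ‖z‖²)⁻² ≤ (ρ⁴)⁻¹`. [folklore] -/
theorem rpow_neg_two_le_inv_pow_four {σ ρ : ℝ} (hσ : 0 < σ) (hρ : 0 < ρ) {z : (EuclideanSpace ℝ (Fin 3))}
    (hz : ρ ≤ ‖z‖) : (σ + ‖z‖ ^ 2) ^ (-(2 : ℝ)) ≤ (ρ ^ 4)⁻¹ := by
  have hρ2 : 0 < ρ ^ 2 := by positivity
  have hle : ρ ^ 2 ≤ σ + ‖z‖ ^ 2 := by nlinarith [norm_nonneg z]
  calc (σ + ‖z‖ ^ 2) ^ (-(2 : ℝ)) ≤ (ρ ^ 2) ^ (-(2 : ℝ)) :=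
        Real.rpow_le_rpow_of_nonpos hρ2 hle (by norm_num)
    _ = (ρ ^ 4)⁻¹ := by
        rw [Real.rpow_neg hρ2.le, Real.rpow_two]
        ring

/-- **Near/far bound for the Oseen slice operator.** There is an absolute constant `C > 0` such
that for every `σ > 0`, every radius `ρ > 0`, every point `x` and all fields `a, b` on `(EuclideanSpace ℝ (Fin 3))` with
`∫ ‖a‖‖b‖ ≤ J` and `‖a y‖‖b y‖ ≤ η` on the ball `‖y - x‖ < ρ`:
`‖N_σ[a,b](x)‖ ≤ C ρ⁻⁴ J + C σ^{-1/2} η`. (Kernel bound (3.8): `≤ C₀ ρ⁻⁴` on the far sources,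
`≤ C₀(σ + ‖x-y‖²)⁻²` with `∫ (σ+‖z‖²)⁻² dz = σ^{-1/2} ∫ (1+‖w‖²)⁻² dw` on the near ones; no
measurability is needed since `‖∫ f‖ ≤ ∫⁻ ‖f‖`.) [folklore] -/
theorem exists_norm_oseenSlice_le_far_add_near :
    ∃ C : ℝ, 0 < C ∧ ∀ {σ : ℝ}, 0 < σ → ∀ {a b : (EuclideanSpace ℝ (Fin 3)) → (EuclideanSpace ℝ (Fin 3))} {x : (EuclideanSpace ℝ (Fin 3))} {ρ J η : ℝ},
      0 < ρ → 0 ≤ J → 0 ≤ η →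
      (∫⁻ y, ‖a y‖ₑ * ‖b y‖ₑ ≤ ENNReal.ofReal J) →
      (∀ y, ‖y - x‖ < ρ → ‖a y‖ * ‖b y‖ ≤ η) →
        ‖oseenSlice σ a b x‖ ≤ C * (ρ ^ 4)⁻¹ * J + C * σ ^ (-(1 / 2 : ℝ)) * η := by
  obtain ⟨C₀, hC₀, hK⟩ := exists_norm_oseenKernel_three_le
  set I : ℝ := ∫ w : (EuclideanSpace ℝ (Fin 3)), (1 + ‖w‖ ^ 2) ^ (-(2 : ℝ)) with hI
  have hfin : (Module.finrank ℝ (EuclideanSpace ℝ (Fin 3)) : ℝ) = 3 := by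
    rw [finrank_euclideanSpace_fin]; norm_num
  have he : (Module.finrank ℝ (EuclideanSpace ℝ (Fin 3)) : ℝ) < 2 * 2 := by rw [hfin]; norm_num
  have hI0 : 0 < I := integral_one_add_norm_sq_rpow_neg_pos he
  refine ⟨C₀ + C₀ * I, by positivity, fun {σ} hσ {a b x ρ J η} hρ hJ hη hint hnear => ?_⟩
  have hCfar : C₀ ≤ C₀ + C₀ * I := le_add_of_nonneg_right (by positivity)
  have hCnear : C₀ * I ≤ C₀ + C₀ * I := le_add_of_nonneg_left hC₀.le
  -- the far set and its complement
  set F : Set (EuclideanSpace ℝ (Fin 3)) := {y | ρ ≤ ‖y - x‖} with hF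
  have hc : Continuous fun y : (EuclideanSpace ℝ (Fin 3)) => ‖y - x‖ := by fun_prop
  have hFm : MeasurableSet F := (isClosed_le continuous_const hc).measurableSet
  -- pointwise bounds on the integrand
  set f : (EuclideanSpace ℝ (Fin 3)) → (EuclideanSpace ℝ (Fin 3)) := fun y => oseenKernel σ (x - y) (a y) (b y) with hf
  have hfar : ∀ y ∈ F, ‖f y‖ₑ ≤ ENNReal.ofReal (C₀ * (ρ ^ 4)⁻¹) * (‖a y‖ₑ * ‖b y‖ₑ) := by
    intro y hy
    have hxy : ρ ≤ ‖x - y‖ := by rw [norm_sub_rev]; exact hy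
    rw [← ofReal_norm, ← ofReal_norm, ← ofReal_norm,
      ← ENNReal.ofReal_mul (norm_nonneg _), ← ENNReal.ofReal_mul (by positivity)]
    refine ENNReal.ofReal_le_ofReal ?_
    calc ‖f y‖ ≤ C₀ * (σ + ‖x - y‖ ^ 2) ^ (-(2 : ℝ)) * ‖a y‖ * ‖b y‖ := hK hσ _ _ _
      _ ≤ C₀ * (ρ ^ 4)⁻¹ * ‖a y‖ * ‖b y‖ := by
          gcongr
          exact rpow_neg_two_le_inv_pow_four hσ hρ hxy
      _ = C₀ * (ρ ^ 4)⁻¹ * (‖a y‖ * ‖b y‖) := by ring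
  have hnear' : ∀ y ∈ Fᶜ, ‖f y‖ₑ ≤
      ENNReal.ofReal (C₀ * η) * ENNReal.ofReal ((σ + ‖x - y‖ ^ 2) ^ (-(2 : ℝ))) := by
    intro y hy
    have hyx : ‖y - x‖ < ρ := by
      simp only [hF, mem_compl_iff, mem_setOf_eq, not_le] at hy; exact hy
    have hab := hnear y hyx
    rw [← ofReal_norm, ← ENNReal.ofReal_mul (by positivity)]
    refine ENNReal.ofReal_le_ofReal ?_
    have hw : 0 ≤ C₀ * (σ + ‖x - y‖ ^ 2) ^ (-(2 : ℝ)) :=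
      mul_nonneg hC₀.le (Real.rpow_nonneg (by positivity) _)
    calc ‖f y‖ ≤ C₀ * (σ + ‖x - y‖ ^ 2) ^ (-(2 : ℝ)) * ‖a y‖ * ‖b y‖ := hK hσ _ _ _
      _ = C₀ * (σ + ‖x - y‖ ^ 2) ^ (-(2 : ℝ)) * (‖a y‖ * ‖b y‖) := by ring
      _ ≤ C₀ * (σ + ‖x - y‖ ^ 2) ^ (-(2 : ℝ)) * η := mul_le_mul_of_nonneg_left hab hw
      _ = C₀ * η * (σ + ‖x - y‖ ^ 2) ^ (-(2 : ℝ)) := by ring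
  -- the far integral
  have hIfar : ∫⁻ y in F, ‖f y‖ₑ ≤ ENNReal.ofReal (C₀ * (ρ ^ 4)⁻¹) * ENNReal.ofReal J := by
    calc ∫⁻ y in F, ‖f y‖ₑ
        ≤ ∫⁻ y in F, ENNReal.ofReal (C₀ * (ρ ^ 4)⁻¹) * (‖a y‖ₑ * ‖b y‖ₑ) :=
          setLIntegral_mono' hFm hfar
      _ = ENNReal.ofReal (C₀ * (ρ ^ 4)⁻¹) * ∫⁻ y in F, ‖a y‖ₑ * ‖b y‖ₑ :=
          lintegral_const_mul' _ _ ENNReal.ofReal_ne_top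
      _ ≤ ENNReal.ofReal (C₀ * (ρ ^ 4)⁻¹) * ∫⁻ y, ‖a y‖ₑ * ‖b y‖ₑ :=
          mul_le_mul_right (setLIntegral_le_lintegral _ _) _
      _ ≤ ENNReal.ofReal (C₀ * (ρ ^ 4)⁻¹) * ENNReal.ofReal J := mul_le_mul_right hint _
  -- the near integral
  have hscal : (Module.finrank ℝ (EuclideanSpace ℝ (Fin 3)) : ℝ) / 2 - 2 = -(1 / 2 : ℝ) := by rw [hfin]; norm_num
  set w : (EuclideanSpace ℝ (Fin 3)) → ℝ≥0∞ := fun z => ENNReal.ofReal ((σ + ‖z‖ ^ 2) ^ (-(2 : ℝ))) with hw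
  have htrans : ∫⁻ y, w (x - y) = ∫⁻ z, w z := lintegral_sub_left_eq_self w x
  have hwint : ∫⁻ z, w z = ENNReal.ofReal (σ ^ (-(1 / 2 : ℝ)) * I) := by
    rw [hw, lintegral_add_norm_sq_rpow_neg he hσ, hscal]
  have hInear : ∫⁻ y in Fᶜ, ‖f y‖ₑ ≤
      ENNReal.ofReal (C₀ * η) * ENNReal.ofReal (σ ^ (-(1 / 2 : ℝ)) * I) := by
    calc ∫⁻ y in Fᶜ, ‖f y‖ₑ
        ≤ ∫⁻ y in Fᶜ, ENNReal.ofReal (C₀ * η) * w (x - y) := setLIntegral_mono' hFm.compl hnear'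
      _ ≤ ∫⁻ y, ENNReal.ofReal (C₀ * η) * w (x - y) := setLIntegral_le_lintegral _ _
      _ = ENNReal.ofReal (C₀ * η) * ∫⁻ y, w (x - y) :=
          lintegral_const_mul' _ _ ENNReal.ofReal_ne_top
      _ = ENNReal.ofReal (C₀ * η) * ENNReal.ofReal (σ ^ (-(1 / 2 : ℝ)) * I) := by
          rw [htrans, hwint]
  -- assemble
  have hsum : ‖oseenSlice σ a b x‖ₑ ≤ ENNReal.ofReal (C₀ * (ρ ^ 4)⁻¹) * ENNReal.ofReal J +
      ENNReal.ofReal (C₀ * η) * ENNReal.ofReal (σ ^ (-(1 / 2 : ℝ)) * I) := by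
    calc ‖oseenSlice σ a b x‖ₑ = ‖∫ y, f y‖ₑ := by rw [oseenSlice_apply]
      _ ≤ ∫⁻ y, ‖f y‖ₑ := enorm_integral_le_lintegral_enorm _
      _ = (∫⁻ y in F, ‖f y‖ₑ) + ∫⁻ y in Fᶜ, ‖f y‖ₑ := (lintegral_add_compl _ hFm).symm
      _ ≤ _ := add_le_add hIfar hInear
  have hnn : 0 ≤ (C₀ + C₀ * I) * (ρ ^ 4)⁻¹ * J + (C₀ + C₀ * I) * σ ^ (-(1 / 2 : ℝ)) * η := by
    positivity
  rw [← ENNReal.ofReal_mul (by positivity), ← ENNReal.ofReal_mul (by positivity),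
    ← ENNReal.ofReal_add (by positivity) (by positivity), ← ofReal_norm] at hsum
  have hreal := (ENNReal.ofReal_le_ofReal_iff (by positivity)).1 hsum
  refine hreal.trans ?_
  have hσpow : 0 ≤ σ ^ (-(1 / 2 : ℝ)) := Real.rpow_nonneg hσ.le _
  calc C₀ * (ρ ^ 4)⁻¹ * J + C₀ * η * (σ ^ (-(1 / 2 : ℝ)) * I)
      = C₀ * (ρ ^ 4)⁻¹ * J + C₀ * I * σ ^ (-(1 / 2 : ℝ)) * η := by ring
    _ ≤ (C₀ + C₀ * I) * (ρ ^ 4)⁻¹ * J + (C₀ + C₀ * I) * σ ^ (-(1 / 2 : ℝ)) * η := by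
        gcongr

/-! ### The Duhamel estimate -/

/-- **Near/far bound for the Oseen–Duhamel term** (`ν = 1`). There is an absolute constant
`C > 0` such that for all `s ≤ t`, all fields `a, b` on `(s,t) × (EuclideanSpace ℝ (Fin 3))`, every point `x` and radius
`ρ > 0`: if `∫ ‖a τ‖‖b τ‖ ≤ J` and `‖a τ y‖‖b τ y‖ ≤ η` on `‖y - x‖ < ρ` for all `τ ∈ (s,t)`,
then `‖B¹_s(a,b)(t)(x)‖ ≤ C (t-s) ρ⁻⁴ J + C √(t-s) η`. (Time integral of the slice estimate:
`∫_{(s,t)} (t-τ)^{-1/2} dτ = 2√(t-s)`; no measurability needed, `‖∫ f‖ ≤ ∫ g` for `‖f‖ ≤ g` a.e.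
with `g` integrable.) This is the estimate propagating spatial decay along mild solutions
(Brandolese 2004, §2). [folklore] -/
theorem exists_norm_oseenDuhamel_le_far_add_near :
    ∃ C : ℝ, 0 < C ∧ ∀ {a b : ℝ → EuclideanSpace ℝ (Fin 3) → EuclideanSpace ℝ (Fin 3)} {s t : ℝ},
      s ≤ t → ∀ {x : EuclideanSpace ℝ (Fin 3)} {ρ J η : ℝ}, 0 < ρ → 0 ≤ J → 0 ≤ η →
      (∀ τ ∈ Set.Ioo s t, ∫⁻ y, ‖a τ y‖ₑ * ‖b τ y‖ₑ ≤ ENNReal.ofReal J) →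
      (∀ τ ∈ Set.Ioo s t, ∀ y, ‖y - x‖ < ρ → ‖a τ y‖ * ‖b τ y‖ ≤ η) →
      ‖Literature.Analysis.FluidPDE.oseenDuhamel 1 s a b t x‖ ≤
        C * (t - s) * (ρ ^ 4)⁻¹ * J + C * (2 * Real.sqrt (t - s)) * η := by
  obtain ⟨C, hC, hslice⟩ := exists_norm_oseenSlice_le_far_add_near
  refine ⟨C, hC, fun {a b s t} hst {x ρ J η} hρ hJ hη hint hnear => ?_⟩
  set g : ℝ → ℝ := fun τ => C * (ρ ^ 4)⁻¹ * J + (t - τ) ^ (-(1 / 2 : ℝ)) * (C * η) with hg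
  have hk : IntegrableOn (fun τ : ℝ => (t - τ) ^ (-(1 / 2 : ℝ))) (Ioo s t) :=
    integrableOn_sub_rpow_Ioo (by norm_num)
  have hgi : IntegrableOn g (Ioo s t) := by
    refine Integrable.add ?_ (hk.mul_const _)
    exact integrableOn_const measure_Ioo_lt_top.ne
  rw [oseenDuhamel_one_eq_setIntegral_oseenSlice]
  refine (norm_integral_le_of_norm_le hgi ?_).trans (le_of_eq ?_)
  · filter_upwards [ae_restrict_mem measurableSet_Ioo] with τ hτ
    have hσ : 0 < t - τ := sub_pos.2 hτ.2
    calc ‖oseenSlice (t - τ) (a τ) (b τ) x‖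
        ≤ C * (ρ ^ 4)⁻¹ * J + C * (t - τ) ^ (-(1 / 2 : ℝ)) * η :=
          hslice hσ hρ hJ hη (hint τ hτ) (hnear τ hτ)
      _ = g τ := by simp only [hg]; ring
  · rw [hg, integral_add (integrableOn_const (C := C * (ρ ^ 4)⁻¹ * J) measure_Ioo_lt_top.ne)
      (hk.mul_const _),
      integral_mul_const (C * η), setIntegral_Ioo_sub_rpow_neg_half hst, setIntegral_const,
      Real.volume_real_Ioo_of_le hst, ← Real.sqrt_eq_rpow, smul_eq_mul]
    ring

end Summit.NavierStokesRegularity.NavierStokesRegularity.Theorems.PlanarEnergyAPriori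

end
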